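import Literature.AlgebraicGeometry.HodgeTheory.HodgeConjectureProductsThreefoldsSmallChowZero
import Literature.AlgebraicGeometry.HodgeTheory.MaxRationalSubHodgeStructureKunnethSymmetric
import Literature.AlgebraicGeometry.Motives.FanoRationallyChainConnected
import HarnessLib

/-!
# `HC(C × X)` from coniveau on the odd cohomology of `X`; `HC(C × T)` for EVERY curve and `HC(S × T)` for EVERY surface when `H³(T)` is supported on a divisor (`CH₀(T)` on a surface, `T` rationally
# chain connected, `T` a hypersurface threefold of degree `≤ 4`), up to the one clause `p_g(S)·h^{2,0}(T) = 0`
# (Voisin I §11.3.3 Thm. 11.38–11.40, Lemma 11.41, pp. 285–287, Thm. 11.30; Voisin II Thm. 10.17, Cor. 10.18/10.21, Thm. 10.31; Bloch–Srinivas 1983 Thm. 1; Voisin 2013 Lemma 2.1; Grothendieck 1969; Murre; KMM92)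

Family `hodge`, lane `lit-hodgefound` (Track 2 foundations library; Layers A1/A4), layer `Literature/AlgebraicGeometry/HodgeTheory`.  THEOREMS ONLY (no definition, no named fact, no instance;
D-0026 net debt `0`).  Companion of the seat's g33-#3 (`BettiHodgeConjectureProductOfThreefoldsConiveauOrHodgeNumbers`: each reduced Künneth piece of `T × T'` killed by Hodge numbers OR by coniveau); here
the FIRST factor is a curve or a surface and the mechanism is coniveau.  For a curve `C` the reduced window of `C × X` consists of the pieces `H¹(C) ⊗ H^{2p+1}(X) ⊂ H^{2p+2}(C × X)`, `1 ≤ p`, and Voisin 2013 Lemma 2.1 on the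
tree's carriers (`BettiUniverse.ofRatClass_crossMap_mem_algebraicClasses_of_supportedClasses_eq_top`, `N⁰H¹(C) = H¹(C)`) makes such a piece algebraic as soon as **`Nᵖ H^{2p+1}(X) = H^{2p+1}(X)`**
(§1); for `X = T` a threefold this is the single condition `N¹H³(T) = H³(T)` — NO condition on the genus of `C` or on `h^{2,1}(T)` (the tree's numerical `C × T` theorems need `h^{2,1}(T) = 0`).  Since
`N¹H³(T) = H³(T)` holds when `CH₀(T)` is supported on a surface (Bloch–Srinivas, the tree's `supportedClasses_three_one_eq_top_of_hasChowZeroSupportedInDimLE_two`), for rationally chain connected `T`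
(`CH₀ = ℤ`), for Fano threefolds granted Kollár–Miyaoka–Mori, and for smooth hypersurface threefolds of degree `≤ 4` (the tree's `IsSmoothHypersurface.supportedClasses_three_one_eq_top_of_degree_le_four`),
**`HC(C × T)` holds for every curve `C` and every such `T` — e.g. every curve times every smooth cubic or quartic threefold** (§1).  For a surface `S` the pieces are `H¹(S) ⊗ H³(T)` (of coniveau `≥ 1` when
`N¹H³(T) = H³(T)`; numerically void when `q(S)·h^{2,1}(T) = 0`, the tree's numerical theorem) and `H²(S) ⊗ H²(T)` (one factor of divisor classes: `p_g(S)·h^{2,0}(T) = 0`): §2, whence **`HC(S × T)` for EVERY surface `S` and every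
threefold `T` with `CH₀` on a curve, or rationally chain connected, or Fano (KMM), or a hypersurface of degree `≤ 4` in `ℙ⁴`** — the tree's `BettiUniverse.hodgeConjectureFor_surface_tensor_threefold_*`
theorems all need `q(S) = 0` or `h^{2,1}(T) = 0` for the first piece.  Mirrors `T × C`, `T × S` by the tree's `hodgeConjectureFor_tensor_comm_mp`.

WHAT IS PROVED.
* §1 **`BettiUniverse.hodgeConjectureFor_curve_tensor_of_forall_supportedClasses_eq_top`** (`HC(X)` and `NᵖH^{2p+1}(X) = H^{2p+1}(X)` for `1 ≤ p`, `2p + 1 ≤ n` ⟹ `HC(C × X)`),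
  **`BettiUniverse.hodgeConjectureFor_curve_tensor_threefold_of_supportedClasses_three_eq_top`**, **`hodgeConjectureFor_curve_tensor_threefold_of_hasChowZeroSupportedInDimLE_two`** (hypothesis-free),
  **`…_of_isRationallyChainConnected`**, **`…_of_isFano`** (granted `KollarMiyaokaMori1992_fano_rationallyChainConnected`), **`IsSmoothHypersurface.hodgeConjectureFor_curve_tensor_of_degree_le_four`** + mirror.
* §2 **`BettiUniverse.hodgeConjectureFor_surface_tensor_threefold_of_supportedClasses_three_eq_top`** (`N¹H³(T) = H³(T)` and `h^{2,0}(S)·h^{2,0}(T) = 0` ⟹ `HC(S × T)`),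
  **`hodgeConjectureFor_surface_tensor_threefold_of_hasChowZeroSupportedInDimLE_two`** (`p_g(S)·h^{2,0}(T) = 0`),
  **`…_of_hasChowZeroSupportedInDimLE_one`** (hypothesis-free), **`…_of_isRationallyChainConnected`**, **`…_of_isFano`**, **`IsSmoothHypersurface.hodgeConjectureFor_surface_tensor_of_degree_le_four`** + mirror.

THE PRINTS.  C. Voisin (2002) [VoisinHodgeI2002] §7.1.1; §11.3.1 Thm. 11.30; §11.3.3 Thm. 11.38–11.40, Lemma 11.41 and pp. 285–287.  C. Voisin (2003) [VoisinHodgeII2003] §10.2.2 Thm. 10.17, Cor. 10.18, Cor. 10.21; §10.3.1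
Thm. 10.31; §9.2.4 Prop. 9.20.  S. Bloch, V. Srinivas (1983) [BlochSrinivas1983] Thm. 1.  C. Voisin (2013) [Voisin2013GHCBloch] Lemma 2.1 (proof).  A. Grothendieck (1969) [GrothendieckTopology1969] §1, p. 300.
J. Kollár, Y. Miyaoka, S. Mori (1992) [KollarMiyaokaMori1992] Thm. 3.3.  A. Arapura (2006) [Arapura2006] §4 Lemma 4.2.  P. Deligne (2000/2006) [Deligne2000] §1.

THE OBJECTS (all the tree's).  `BettiUniverse.kunnethSummand`, `BettiUniverse.crossMap`, `BettiUniverse.hodge`, `HodgeStructure.hodgeNumber`, `hodgeClasses`, `supportedClasses`, `algebraicClasses`,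
`ofRatClass`, `HodgeConjectureFor`, `Barriers.HodgeConjecture.HasChowZeroSupportedInDimLE`, `IsRationallyChainConnected`, `IsFano`, `Motives.IsSmoothHypersurface 3 e`; the tree's assemblies
`BettiUniverse.hodgeConjectureFor_curve_tensor_of_kunneth_pieces`, `BettiUniverse.hodgeConjectureFor_surface_tensor_of_kunneth_pieces`, the piece lemmas
`BettiUniverse.ofRatClass_crossMap_mem_algebraicClasses_of_supportedClasses_eq_top`, `…_of_hodgeClasses_eq_top_left/right`, and `supportedClasses_zero`, `supportedClasses_eq_top_of_hasChowZeroSupportedInDimLE_of_lt`,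
`BettiUniverse.hodgeNumber_eq_zero_of_hasChowZeroSupportedInDimLE_of_lt`, `IsRationallyChainConnected.hasChowZeroSupportedInDimLE_zero`, `IsSmoothHypersurface.hasChowZeroSupportedInDimLE_of_degree_le_succ`,
`hodgeConjectureFor_tensor_comm_mp`, `hodgeTensorFacts_holds`, `exists_isReal_hodgeModel_holds`, `IsSmoothProjective.tensor_holds`.

DEVIATIONS / SCOPE.  Complex orientations (through the tree's supported-classes and Künneth-piece lemmas).  The general statements keep `[HodgeTensorFacts.{0,0}]`, `hHD` and an arbitrary smooth projective
structure on the product; the `CH₀` corollaries discharge all three.  No definitions.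

## References
* [VoisinHodgeI2002] C. Voisin, *Hodge Theory and Complex Algebraic Geometry I* (2002) — §7.1.1; §11.3.1 Thm. 11.30; §11.3.3 Thm. 11.38–11.40, Lemma 11.41, pp. 285–287.
* [VoisinHodgeII2003] C. Voisin, *Hodge Theory and Complex Algebraic Geometry II* (2003) — §9.2.4 Prop. 9.20; §10.2.2 Thm. 10.17, Cor. 10.18, Cor. 10.21; §10.3.1 Thm. 10.31.
* [BlochSrinivas1983] S. Bloch, V. Srinivas, Remarks on correspondences and algebraic cycles, Amer. J. Math. 105 (1983) — Thm. 1.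
* [Voisin2013GHCBloch] C. Voisin, The generalized Hodge and Bloch conjectures are equivalent for general complete intersections (2013) — Lemma 2.1.
* [GrothendieckTopology1969] A. Grothendieck, Hodge's general conjecture is false for trivial reasons, Topology 8 (1969) — §1, p. 300.
* [KollarMiyaokaMori1992] J. Kollár, Y. Miyaoka, S. Mori, Rational connectedness and boundedness of Fano manifolds (1992) — Thm. 3.3.
* [Arapura2006] D. Arapura, Motivation for Hodge cycles (2006) — §4 Lemma 4.2.
* [Deligne2000] P. Deligne, *The Hodge conjecture* (Clay problem description) — §1.

## Provenance
Lane `lit-hodgefound` (Hodge path, Track 2), prover seat `lit-hodgefound-p29` (generation 33), self-proposed row g33-#4 (curve / surface first factor against a threefold with `H³` of coniveau `1`).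
-/

noncomputable section

open scoped TensorProduct
open CategoryTheory MonoidalCategory CartesianMonoidalCategory Module Finset
open Literature.AlgebraicTopology.SingularHomology
open Literature.Geometry.Kaehler
open Literature.Barriers.HodgeConjecture

namespace Literature.AlgebraicGeometry.HodgeTheory

open Literature.AlgebraicGeometry.Motives
open Literature.AlgebraicGeometry.Motives.HodgeStructure

variable {n d : ℕ} {X C S T : SchemeOver ℂ}

section Hodge

variable [HodgeTensorFacts.{0, 0}]

/-! ### §1 A curve as first factor -/

/-- **`HC(C × X)` for a smooth projective curve `C` and a smooth projective `n`-fold `X` with `HC(X)` whose odd cohomology is of the maximal coniveau: `Nᵖ H^{2p+1}(X) = H^{2p+1}(X)` for `1 ≤ p`,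
`2p + 1 ≤ n`.**  The reduced window of `C × X` consists of the pieces `H¹(C) ⊗ H^{2p+1}(X) ⊂ H^{2p+2}(C × X)`, and a Hodge class of such a piece is a rational class of type `(p+1, p+1)` supported in
codimension `≥ 0 + p` (`N⁰H¹(C) = H¹(C)`), hence algebraic (Voisin 2013 Lemma 2.1 on the tree's carriers). [cite: Voisin2013GHCBloch, Lemma 2.1 (proof)] [cite: GrothendieckTopology1969, §1, p. 300]
[cite: VoisinHodgeI2002, §11.3.3 Thm. 11.38–11.40, Lemma 11.41 and pp. 285–287, §11.3.1 Thm. 11.30] [cite: Deligne2000, §1] -/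
theorem BettiUniverse.hodgeConjectureFor_curve_tensor_of_forall_supportedClasses_eq_top (hHD : exists_isReal_hodgeModel) (hC : IsSmoothProjective 1 C) (hX : IsSmoothProjective n X)
    (hCX : IsSmoothProjective d (C ⊗ X)) (hHCX : HodgeConjectureFor n X) (h : ∀ p : ℕ, 1 ≤ p → 2 * p + 1 ≤ n → supportedClasses X (2 * p + 1) p = ⊤) :
    HodgeConjectureFor d (C ⊗ X) := by
  refine BettiUniverse.hodgeConjectureFor_curve_tensor_of_kunneth_pieces hHD hC hX hCX hHCX fun c j hj hj3 hjn t ht ↦ ?_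
  obtain ⟨p, rfl⟩ : ∃ p, c = p + 1 := ⟨c - 1, by omega⟩
  obtain rfl : j = 2 * p + 1 := by omega
  exact BettiUniverse.ofRatClass_crossMap_mem_algebraicClasses_of_supportedClasses_eq_top hHD hC hX hCX (i := 1) (j := 2 * p + 1) (p := p) (r := 0) (s := p) (by ring) (by omega)
    (supportedClasses_zero C 1) (h p (by omega) hjn) ht

/-- **`HC(C × T)` for every smooth projective curve `C` and every smooth projective threefold `T` with `N¹H³(T) = H³(T)`** (`H³` supported on a divisor) — no condition on the genus of `C` or on `h^{2,1}(T)`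
(`HC(T)` is the tree's `hodgeConjectureFor_of_dim_le_three_holds`). [cite: Voisin2013GHCBloch, Lemma 2.1 (proof)] [cite: GrothendieckTopology1969, §1, p. 300] [cite: VoisinHodgeI2002, §11.3.3 Thm. 11.38, Lemma 11.41 and p. 287] [cite: Deligne2000, §1] -/
theorem BettiUniverse.hodgeConjectureFor_curve_tensor_threefold_of_supportedClasses_three_eq_top (hHD : exists_isReal_hodgeModel) (hC : IsSmoothProjective 1 C) (hT : IsSmoothProjective 3 T)
    (hCT : IsSmoothProjective d (C ⊗ T)) (h3 : supportedClasses T 3 1 = ⊤) : HodgeConjectureFor d (C ⊗ T) := by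
  refine BettiUniverse.hodgeConjectureFor_curve_tensor_of_forall_supportedClasses_eq_top hHD hC hT hCT (hodgeConjectureFor_of_dim_le_three_holds le_rfl hT) fun p hp1 hp ↦ ?_
  obtain rfl : p = 1 := by omega
  exact h3

/-! ### §2 A surface as first factor -/

/-- **`HC(S × T)` for every smooth projective surface `S` and every smooth projective threefold `T` with `N¹H³(T) = H³(T)` and `h^{2,0}(S)·h^{2,0}(T) = 0`.**  The reduced window of `S × T` has the
pieces `H¹(S) ⊗ H³(T)` — of coniveau `≥ 0 + 1 = c − 1` when `N¹H³(T) = H³(T)` (Voisin 2013 Lemma 2.1 on the tree's carriers), with NO condition on `q(S)` or `h^{2,1}(T)` — and `H²(S) ⊗ H²(T)` (one factor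
consisting of divisor classes).  The tree's `BettiUniverse.hodgeConjectureFor_surface_tensor_threefold_of_hodgeNumber_eq_zero` is the numerical companion ([`h^{1,0}(S) = 0` or `h^{2,1}(T) = 0`] for the
first piece). [cite: Voisin2013GHCBloch, Lemma 2.1 (proof)] [cite: VoisinHodgeI2002, §7.1.1, §11.3.3 Thm. 11.38–11.40, Lemma 11.41 and pp. 285–287, §11.3.1 Thm. 11.30] [cite: VoisinHodgeII2003, §9.2.4 Prop. 9.20] [cite: Deligne2000, §1] -/
theorem BettiUniverse.hodgeConjectureFor_surface_tensor_threefold_of_supportedClasses_three_eq_top (hHD : exists_isReal_hodgeModel) (hS : IsSmoothProjective 2 S) (hT : IsSmoothProjective 3 T)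
    (hST : IsSmoothProjective d (S ⊗ T)) (h3 : supportedClasses T 3 1 = ⊤) (h20 : (BettiUniverse.hodge hHD hS 2).hodgeNumber 2 0 * (BettiUniverse.hodge hHD hT 2).hodgeNumber 2 0 = 0) :
    HodgeConjectureFor d (S ⊗ T) := by
  have hHCS : HodgeConjectureFor 2 S := hodgeConjectureFor_of_dim_le_three_holds (by norm_num) hS
  have hHCT : HodgeConjectureFor 3 T := hodgeConjectureFor_of_dim_le_three_holds le_rfl hT
  have halgS : ∀ (p : ℕ), ∀ z ∈ (BettiUniverse.hodge hHD hS (2 * p)).hodgeClasses (p : ℤ), ofRatClass (ComplexPoints S) (2 * p) z ∈ algebraicClasses S p :=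
    fun p z hz ↦ hHCS.2 p _ (isRationalClass_ofRatClass _) ((BettiUniverse.mem_hodgeClasses_hodge_iff_isOfHodgeType hHD hS p z).1 hz)
  have halgT : ∀ (p : ℕ), ∀ z ∈ (BettiUniverse.hodge hHD hT (2 * p)).hodgeClasses (p : ℤ), ofRatClass (ComplexPoints T) (2 * p) z ∈ algebraicClasses T p :=
    fun p z hz ↦ hHCT.2 p _ (isRationalClass_ofRatClass _) ((BettiUniverse.mem_hodgeClasses_hodge_iff_isOfHodgeType hHD hT p z).1 hz)
  refine BettiUniverse.hodgeConjectureFor_surface_tensor_of_kunneth_pieces hHD hS hT hST hHCT (fun c j hj hj3 hjn t ht ↦ ?_) fun c j hj hj2 hjn t ht ↦ ?_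
  · -- `H¹(S) ⊗ H³(T)`: coniveau `≥ 1`
    obtain rfl : j = 3 := by omega
    obtain rfl : c = 2 := by omega
    exact BettiUniverse.ofRatClass_crossMap_mem_algebraicClasses_of_supportedClasses_eq_top hHD hS hT hST (i := 1) (j := 3) (p := 1) (r := 0) (s := 1) (by norm_num) (by norm_num)
      (supportedClasses_zero S 1) h3 ht
  · -- `H²(S) ⊗ H²(T)` (for `j = 3` the index `2 + 3` is odd)
    obtain rfl : j = 2 := by omega
    obtain rfl : c = 2 := by omega
    rcases mul_eq_zero.1 h20 with h | h
    · have htop : (BettiUniverse.hodge hHD hS (2 * 1)).hodgeClasses (1 : ℕ) = ⊤ := (BettiUniverse.hodgeClasses_hodge_two_eq_top_iff hHD hS).2 h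
      exact BettiUniverse.ofRatClass_crossMap_mem_algebraicClasses_of_hodgeClasses_eq_top_left hHD hS hT (a := 1) (b := 1) (c := 2) (by norm_num) htop
        (fun u ↦ halgS 1 u (by rw [htop]; exact Submodule.mem_top)) (halgT 1) ht
    · have htop : (BettiUniverse.hodge hHD hT (2 * 1)).hodgeClasses (1 : ℕ) = ⊤ := (BettiUniverse.hodgeClasses_hodge_two_eq_top_iff hHD hT).2 h
      exact BettiUniverse.ofRatClass_crossMap_mem_algebraicClasses_of_hodgeClasses_eq_top_right hHD hS hT (a := 1) (b := 1) (c := 2) (by norm_num) htop (halgS 1)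
        (fun w ↦ halgT 1 w (by rw [htop]; exact Submodule.mem_top)) ht

/-- **`HC(S × T)` for every smooth projective surface `S` and every smooth projective threefold `T` whose `CH₀` is supported on a surface, provided `h^{2,0}(S)·h^{2,0}(T) = 0`** (Bloch–Srinivas:
`N¹H³(T) = H³(T)`). [cite: BlochSrinivas1983, Thm. 1] [cite: VoisinHodgeII2003, §10.2.2 Thm. 10.17 and Cor. 10.21] [cite: Voisin2013GHCBloch, Lemma 2.1 (proof)] [cite: Deligne2000, §1] -/
theorem hodgeConjectureFor_surface_tensor_threefold_of_hasChowZeroSupportedInDimLE_two (hHD : exists_isReal_hodgeModel) (hS : IsSmoothProjective 2 S) (hT : IsSmoothProjective 3 T)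
    (hW : HasChowZeroSupportedInDimLE T 2) (h20 : (BettiUniverse.hodge hHD hS 2).hodgeNumber 2 0 * (BettiUniverse.hodge hHD hT 2).hodgeNumber 2 0 = 0) : HodgeConjectureFor (2 + 3) (S ⊗ T) :=
  BettiUniverse.hodgeConjectureFor_surface_tensor_threefold_of_supportedClasses_three_eq_top hHD hS hT (hS.tensor_holds hT) (supportedClasses_three_one_eq_top_of_hasChowZeroSupportedInDimLE_two hT hW) h20

end Hodge

/-! ### §3 Hypothesis-free corollaries: `CH₀` on surfaces and curves, rationally chain connected and Fano threefolds -/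

/-- **`HC(C × T)` for every smooth projective curve `C` and every smooth projective threefold `T` whose `CH₀` is supported on a surface** (e.g. uniruled threefolds) — unconditionally.
[cite: BlochSrinivas1983, Thm. 1] [cite: VoisinHodgeII2003, §10.2.2 Thm. 10.17 and Cor. 10.21] [cite: Voisin2013GHCBloch, Lemma 2.1 (proof)] [cite: VoisinHodgeI2002, §11.3.3 Thm. 11.38, Lemma 11.41 and p. 287] [cite: Deligne2000, §1] -/
theorem hodgeConjectureFor_curve_tensor_threefold_of_hasChowZeroSupportedInDimLE_two (hC : IsSmoothProjective 1 C) (hT : IsSmoothProjective 3 T) (hW : HasChowZeroSupportedInDimLE T 2) :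
    HodgeConjectureFor (1 + 3) (C ⊗ T) := by
  haveI : HodgeTensorFacts.{0, 0} := hodgeTensorFacts_holds
  exact BettiUniverse.hodgeConjectureFor_curve_tensor_threefold_of_supportedClasses_three_eq_top exists_isReal_hodgeModel_holds hC hT (hC.tensor_holds hT)
    (supportedClasses_three_one_eq_top_of_hasChowZeroSupportedInDimLE_two hT hW)

/-- Mirror: **`HC(T × C)`**, `CH₀(T)` supported on a surface, `C` any curve (the tree's `hodgeConjectureFor_tensor_comm_mp`). [cite: BlochSrinivas1983, Thm. 1] [cite: Voisin2013GHCBloch, Lemma 2.1 (proof)] [cite: Arapura2006, §4 Lemma 4.2] [cite: Deligne2000, §1] -/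
theorem hodgeConjectureFor_threefold_tensor_curve_of_hasChowZeroSupportedInDimLE_two (hT : IsSmoothProjective 3 T) (hC : IsSmoothProjective 1 C) (hW : HasChowZeroSupportedInDimLE T 2) :
    HodgeConjectureFor (3 + 1) (T ⊗ C) :=
  hodgeConjectureFor_tensor_comm_mp hC hT (hodgeConjectureFor_curve_tensor_threefold_of_hasChowZeroSupportedInDimLE_two hC hT hW)

/-- **`HC(C × T)` for every curve `C` and every RATIONALLY CHAIN CONNECTED smooth projective threefold `T`.** [cite: BlochSrinivas1983, Thm. 1] [cite: VoisinHodgeII2003, §10.2.2 Thm. 10.17 and Cor. 10.18] [cite: Voisin2013GHCBloch, Lemma 2.1 (proof)]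
[cite: Deligne2000, §1] -/
theorem hodgeConjectureFor_curve_tensor_threefold_of_isRationallyChainConnected (hC : IsSmoothProjective 1 C) (hT : IsSmoothProjective 3 T) (hRC : IsRationallyChainConnected T) :
    HodgeConjectureFor (1 + 3) (C ⊗ T) :=
  hodgeConjectureFor_curve_tensor_threefold_of_hasChowZeroSupportedInDimLE_two hC hT ((hRC.hasChowZeroSupportedInDimLE_zero hT).mono (by norm_num))

/-- **`HC(C × F)` for every curve `C` and every FANO threefold `F`, granted the printed fact `KollarMiyaokaMori1992_fano_rationallyChainConnected`.** [cite: KollarMiyaokaMori1992, Thm. 3.3] [cite: BlochSrinivas1983, Thm. 1]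
[cite: Voisin2013GHCBloch, Lemma 2.1 (proof)] [cite: Deligne2000, §1] -/
theorem hodgeConjectureFor_curve_tensor_threefold_of_isFano (hKMM : KollarMiyaokaMori1992_fano_rationallyChainConnected) (hC : IsSmoothProjective 1 C) {F : SchemeOver ℂ} (hF : IsFano 3 F) :
    HodgeConjectureFor (1 + 3) (C ⊗ F) :=
  hodgeConjectureFor_curve_tensor_threefold_of_hasChowZeroSupportedInDimLE_two hC hF.isSmoothProjective ((hKMM.hasChowZeroSupportedInDimLE_zero hF).mono (by norm_num))

/-- **`HC(S × T)` for every smooth projective surface `S` and every smooth projective threefold `T` whose `CH₀` is supported on a CURVE** — unconditionally, no Hodge-number hypothesis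
(`h^{2,0}(T) = 0` and `N¹H³(T) = H³(T)` by Bloch–Srinivas). [cite: BlochSrinivas1983, Thm. 1] [cite: VoisinHodgeII2003, §10.2.2 Thm. 10.17, Cor. 10.18 and Cor. 10.21] [cite: Voisin2013GHCBloch, Lemma 2.1 (proof)]
[cite: VoisinHodgeI2002, §11.3.3 Thm. 11.38, Lemma 11.41 and p. 287, §11.3.1 Thm. 11.30] [cite: Deligne2000, §1] -/
theorem hodgeConjectureFor_surface_tensor_threefold_of_hasChowZeroSupportedInDimLE_one (hS : IsSmoothProjective 2 S) (hT : IsSmoothProjective 3 T) (hW : HasChowZeroSupportedInDimLE T 1) :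
    HodgeConjectureFor (2 + 3) (S ⊗ T) := by
  haveI : HodgeTensorFacts.{0, 0} := hodgeTensorFacts_holds
  have h20 := (BettiUniverse.hodgeNumber_eq_zero_of_hasChowZeroSupportedInDimLE_of_lt exists_isReal_hodgeModel_holds hT hW (k := 2) (by norm_num)).2
  exact hodgeConjectureFor_surface_tensor_threefold_of_hasChowZeroSupportedInDimLE_two exists_isReal_hodgeModel_holds hS hT (hW.mono (by norm_num))
    (mul_eq_zero_of_right _ (by simpa using h20))

/-- Mirror: **`HC(T × S)`**, `CH₀(T)` supported on a curve, `S` any surface. [cite: BlochSrinivas1983, Thm. 1] [cite: Voisin2013GHCBloch, Lemma 2.1 (proof)] [cite: Arapura2006, §4 Lemma 4.2] [cite: Deligne2000, §1] -/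
theorem hodgeConjectureFor_threefold_tensor_surface_of_hasChowZeroSupportedInDimLE_one (hT : IsSmoothProjective 3 T) (hS : IsSmoothProjective 2 S) (hW : HasChowZeroSupportedInDimLE T 1) :
    HodgeConjectureFor (3 + 2) (T ⊗ S) :=
  hodgeConjectureFor_tensor_comm_mp hS hT (hodgeConjectureFor_surface_tensor_threefold_of_hasChowZeroSupportedInDimLE_one hS hT hW)

/-- **`HC(S × T)` for every surface `S` and every RATIONALLY CHAIN CONNECTED smooth projective threefold `T`** (`CH₀(T) = ℤ`). [cite: BlochSrinivas1983, Thm. 1] [cite: VoisinHodgeII2003, §10.2.2 Thm. 10.17 and Cor. 10.18] [cite: Voisin2013GHCBloch, Lemma 2.1 (proof)]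
[cite: Deligne2000, §1] -/
theorem hodgeConjectureFor_surface_tensor_threefold_of_isRationallyChainConnected (hS : IsSmoothProjective 2 S) (hT : IsSmoothProjective 3 T) (hRC : IsRationallyChainConnected T) :
    HodgeConjectureFor (2 + 3) (S ⊗ T) :=
  hodgeConjectureFor_surface_tensor_threefold_of_hasChowZeroSupportedInDimLE_one hS hT ((hRC.hasChowZeroSupportedInDimLE_zero hT).mono (by norm_num))

/-- **`HC(S × F)` for every surface `S` and every FANO threefold `F`, granted the printed fact `KollarMiyaokaMori1992_fano_rationallyChainConnected`.** [cite: KollarMiyaokaMori1992, Thm. 3.3] [cite: BlochSrinivas1983, Thm. 1]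
[cite: Voisin2013GHCBloch, Lemma 2.1 (proof)] [cite: Deligne2000, §1] -/
theorem hodgeConjectureFor_surface_tensor_threefold_of_isFano (hKMM : KollarMiyaokaMori1992_fano_rationallyChainConnected) (hS : IsSmoothProjective 2 S) {F : SchemeOver ℂ} (hF : IsFano 3 F) :
    HodgeConjectureFor (2 + 3) (S ⊗ F) :=
  hodgeConjectureFor_surface_tensor_threefold_of_hasChowZeroSupportedInDimLE_one hS hF.isSmoothProjective ((hKMM.hasChowZeroSupportedInDimLE_zero hF).mono (by norm_num))

end Literature.AlgebraicGeometry.HodgeTheory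

/-! ### §4 Smooth hypersurface threefolds of degree `≤ 4` -/

namespace Literature.AlgebraicGeometry.Motives.IsSmoothHypersurface

open Literature.AlgebraicGeometry.Motives
open Literature.AlgebraicGeometry.HodgeTheory
open Literature.Barriers.HodgeConjecture

variable {e : ℕ} {Y C S : SchemeOver ℂ}

/-- **`HC(C × Y)` for every smooth projective curve `C` and every smooth hypersurface threefold `Y ⊂ ℙ⁴_ℂ` of degree `1 ≤ e ≤ 4`** (e.g. every curve times every smooth cubic or quartic threefold) —
unconditionally: `N¹H³(Y) = H³(Y)` is the tree's `supportedClasses_three_one_eq_top_of_degree_le_four`. [cite: BlochSrinivas1983, Thm. 1] [cite: VoisinHodgeII2003, §10.3.1 Thm. 10.31] [cite: Voisin2013GHCBloch, Lemma 2.1 (proof)]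
[cite: VoisinHodgeI2002, §11.3.3 Thm. 11.38, Lemma 11.41 and p. 287] [cite: Deligne2000, §1] -/
theorem hodgeConjectureFor_curve_tensor_of_degree_le_four (hY : IsSmoothHypersurface 3 e Y) (he : 0 < e) (he4 : e ≤ 4) (hC : IsSmoothProjective 1 C) : HodgeConjectureFor (1 + 3) (C ⊗ Y) := by
  haveI : HodgeTensorFacts.{0, 0} := hodgeTensorFacts_holds
  exact BettiUniverse.hodgeConjectureFor_curve_tensor_threefold_of_supportedClasses_three_eq_top exists_isReal_hodgeModel_holds hC hY.1 (hC.tensor_holds hY.1)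
    (hY.supportedClasses_three_one_eq_top_of_degree_le_four he he4)

/-- Mirror: **`HC(Y × C)`** for `Y ⊂ ℙ⁴` smooth of degree `1 ≤ e ≤ 4` and every curve `C`. [cite: BlochSrinivas1983, Thm. 1] [cite: VoisinHodgeII2003, §10.3.1 Thm. 10.31] [cite: Voisin2013GHCBloch, Lemma 2.1 (proof)] [cite: Arapura2006, §4 Lemma 4.2]
[cite: Deligne2000, §1] -/
theorem hodgeConjectureFor_tensor_curve_of_degree_le_four (hY : IsSmoothHypersurface 3 e Y) (he : 0 < e) (he4 : e ≤ 4) (hC : IsSmoothProjective 1 C) : HodgeConjectureFor (3 + 1) (Y ⊗ C) :=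
  hodgeConjectureFor_tensor_comm_mp hC hY.1 (hY.hodgeConjectureFor_curve_tensor_of_degree_le_four he he4 hC)

/-- **`HC(S × Y)` for every smooth projective surface `S` and every smooth hypersurface threefold `Y ⊂ ℙ⁴_ℂ` of degree `1 ≤ e ≤ 4`** — unconditionally (`N¹H³(Y) = H³(Y)`, `h^{2,0}(Y) = 0` as
`H²(Y;ℚ) = Hdg¹`).  The tree's `S × T` theorems needed `q(S) = 0` or `h^{2,1}(T) = 0` for the piece `H¹(S) ⊗ H³`; a cubic threefold has `h^{2,1} = 5`. [cite: BlochSrinivas1983, Thm. 1] [cite: VoisinHodgeII2003, §10.3.1 Thm. 10.31 and §1.2.3 Cor. 1.24–1.25]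
[cite: Voisin2013GHCBloch, Lemma 2.1 (proof)] [cite: VoisinHodgeI2002, §11.3.3 Thm. 11.38, Lemma 11.41 and p. 287, §11.3.1 Thm. 11.30] [cite: Deligne2000, §1] -/
theorem hodgeConjectureFor_surface_tensor_of_degree_le_four (hY : IsSmoothHypersurface 3 e Y) (he : 0 < e) (he4 : e ≤ 4) (hS : IsSmoothProjective 2 S) : HodgeConjectureFor (2 + 3) (S ⊗ Y) := by
  haveI : HodgeTensorFacts.{0, 0} := hodgeTensorFacts_holds
  have h20 : (BettiUniverse.hodge exists_isReal_hodgeModel_holds hY.1 2).hodgeNumber 2 0 = 0 :=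
    (BettiUniverse.hodgeClasses_hodge_two_eq_top_iff exists_isReal_hodgeModel_holds hY.1).1 (hY.hodgeClasses_hodge_eq_top_of_two_mul_ne exists_isReal_hodgeModel_holds hY.1 (p := 1) (by norm_num))
  exact BettiUniverse.hodgeConjectureFor_surface_tensor_threefold_of_supportedClasses_three_eq_top exists_isReal_hodgeModel_holds hS hY.1 (hS.tensor_holds hY.1)
    (hY.supportedClasses_three_one_eq_top_of_degree_le_four he he4) (mul_eq_zero_of_right _ h20)

/-- Mirror: **`HC(Y × S)`** for `Y ⊂ ℙ⁴` smooth of degree `1 ≤ e ≤ 4` and every surface `S`. [cite: BlochSrinivas1983, Thm. 1] [cite: VoisinHodgeII2003, §10.3.1 Thm. 10.31] [cite: Voisin2013GHCBloch, Lemma 2.1 (proof)] [cite: Arapura2006, §4 Lemma 4.2]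
[cite: Deligne2000, §1] -/
theorem hodgeConjectureFor_tensor_surface_of_degree_le_four (hY : IsSmoothHypersurface 3 e Y) (he : 0 < e) (he4 : e ≤ 4) (hS : IsSmoothProjective 2 S) : HodgeConjectureFor (3 + 2) (Y ⊗ S) :=
  hodgeConjectureFor_tensor_comm_mp hS hY.1 (hY.hodgeConjectureFor_surface_tensor_of_degree_le_four he he4 hS)

end Literature.AlgebraicGeometry.Motives.IsSmoothHypersurface

end
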